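import Literature.Topology.FourManifolds.SeifertCircleMapProofs
import Mathlib.Topology.Homotopy.Lifting
import Mathlib.Topology.Homotopy.Product
import Mathlib.AlgebraicTopology.FundamentalGroupoid.SimplyConnected
import Mathlib.Analysis.Convex.Contractible
import HarnessLib

/-!
# Winding numbers of circle-valued maps, degrees of circle maps, and torus maps up to homotopy

Topic `Literature/Topology/FourManifolds`; fourth file of the proof of the symmetry of the linking
number (`Knot.HasLinkingNumber.symm`, Rolfsen, *Knots and Links* (1976), §5.D Thm. 5.D.1), see
`LinkingNumberTorusClass.lean` for the plan. The elementary covering-space theory of the circle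
(A. Hatcher, *Algebraic Topology* (2002), §1.1 Thm. 1.7 and §1.3 Props. 1.30, 1.33, in Mathlib:
`Circle.isCoveringMap_exp`, `IsCoveringMap.liftPath`, `existsUnique_continuousMap_lifts`) packaged
for the linking-number computation:

* `CircleMaps.incr f γ` — the **angle increment** of a circle-valued map `f : X → S¹` along a path
  `γ` in `X` (the increment of any continuous real lift of `f ∘ γ` through `exp : ℝ → S¹`,
  `incr_eq_of_lift`); additive under concatenation, odd under reversal, hence **invariant under
  conjugation** (`incr_conj`), and additive in `f` for pointwise products (`incr_mul`).
* `CircleMaps.winding f γ ∈ ℤ` — for a loop, `incr f γ = 2π · winding f γ`.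
* `CircleMaps.degree g ∈ ℤ` — the degree of `g : S¹ → S¹` (winding along the standard loop);
  `degree (g · h) = degree g + degree h`, `degree g⁻¹ = -degree g`, `degree (z ↦ zⁿ) = n`,
  `degree (const) = 0`.
* **`CircleMaps.homotopic_monomial_of_degree`** — a map `F : T² = S¹ × S¹ → S¹` whose restrictions
  to the two coordinate circles `x ↦ (x, 1)`, `u ↦ (1, u)` have degrees `p`, `q` is homotopic to
  the monomial `(x, u) ↦ x^p u^q` (Hatcher §1.1 Thm. 1.7 / Example 1.13 via the lifting criterion,
  Prop. 1.33: `F / (x^p u^q)` kills `π₁(T²)` hence lifts to `ℝ` over the universal cover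
  `ℝ² → T²`, and the lift descends since both its periods vanish; a real-valued map is
  null-homotopic). Consequently a torus self-map with prescribed bidegrees is homotopic to the
  corresponding pair of monomials (`homotopic_prodMk_of_degree`).

Everything is proved; no named fact is introduced. The new data are the increments/windings/
degrees, the standard loop, the coordinate inclusions and the monomial maps.

## References

* A. Hatcher, *Algebraic Topology*, CUP (2002), §1.1 Thm. 1.7, Example 1.13; §1.3 Prop. 1.30,
  Prop. 1.33. [cite: HatcherAT2002, §1.1 Thm. 1.7]
* D. Rolfsen, *Knots and Links* (1976), §5.D. [cite: Rolfsen1976, §5.D Thm 5.D.1]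
-/

noncomputable section

open Set Function
open scoped unitInterval Real Topology

namespace Literature.Topology.FourManifolds

namespace CircleMaps

variable {X : Type*} [TopologicalSpace X]

/-! ### Real lifts and angle increments of circle-valued paths -/

/-- `exp (arg z) = z` on the circle, in the form needed for lifting initial points. [folklore] -/
theorem comp_path_zero_eq (f : C(X, Circle)) {x y : X} (γ : Path x y) :
    (f.comp γ.toContinuousMap) 0 = Circle.exp ((f x : ℂ).arg) := by
  simp [Circle.exp_arg]

/-- **The real lift** of `f ∘ γ` through `exp : ℝ → S¹` starting at `arg (f x)`
(Hatcher 2002, Prop. 1.30; Mathlib `IsCoveringMap.liftPath`). [cite: HatcherAT2002, Prop. 1.30] -/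
def liftOf (f : C(X, Circle)) {x y : X} (γ : Path x y) : C(I, ℝ) :=
  Circle.isCoveringMap_exp.liftPath (f.comp γ.toContinuousMap) ((f x : ℂ).arg)
    (comp_path_zero_eq f γ)

/-- The real lift lifts. [folklore] -/
theorem exp_liftOf (f : C(X, Circle)) {x y : X} (γ : Path x y) (t : I) :
    Circle.exp (liftOf f γ t) = f (γ t) :=
  congr_fun (Circle.isCoveringMap_exp.liftPath_lifts (f.comp γ.toContinuousMap) ((f x : ℂ).arg)
    (comp_path_zero_eq f γ)) t

/-- **The angle increment** of `f` along `γ`: `Γ(1) - Γ(0)` for the real lift `Γ`. [folklore] -/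
def incr (f : C(X, Circle)) {x y : X} (γ : Path x y) : ℝ := liftOf f γ 1 - liftOf f γ 0

/-- **Any continuous real lift computes the increment** (uniqueness of lifts, Hatcher 2002,
Prop. 1.30 / 1.34). [cite: HatcherAT2002, Prop. 1.30] -/
theorem incr_eq_of_lift (f : C(X, Circle)) {x y : X} (γ : Path x y) {G : I → ℝ}
    (hG : Continuous G) (hlift : ∀ t, Circle.exp (G t) = f (γ t)) : incr f γ = G 1 - G 0 := by
  -- shift `G` to start at the chosen initial point
  set c : ℝ := liftOf f γ 0 - G 0 with hc
  have hexpc : Circle.exp c = 1 := by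
    rw [hc, Circle.exp_sub, exp_liftOf, hlift, div_self']
  have hG' : (fun t ↦ G t + c) = liftOf f γ := by
    rw [liftOf, Circle.isCoveringMap_exp.eq_liftPath_iff]
    refine ⟨hG.add continuous_const, funext fun t ↦ ?_, ?_⟩
    · simp only [Function.comp_apply, ContinuousMap.comp_apply, Path.coe_toContinuousMap]
      rw [Circle.exp_add, hexpc, mul_one, hlift]
    · show G 0 + c = (f x : ℂ).arg
      rw [hc, add_sub_cancel, liftOf, Circle.isCoveringMap_exp.liftPath_zero]
  rw [incr, ← hG']
  ring

/-- Increments only depend on the circle-valued path `t ↦ f (γ t)`. [folklore] -/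
theorem incr_congr {Y : Type*} [TopologicalSpace Y] (f : C(X, Circle)) (g : C(Y, Circle))
    {x y : X} {x' y' : Y} (γ : Path x y) (γ' : Path x' y') (h : ∀ t, f (γ t) = g (γ' t)) :
    incr f γ = incr g γ' :=
  incr_eq_of_lift f γ (liftOf g γ').continuous fun t ↦ by rw [exp_liftOf, h]

/-- The increment along a constant path vanishes. [folklore] -/
theorem incr_refl (f : C(X, Circle)) (x : X) : incr f (Path.refl x) = 0 := by
  rw [incr_eq_of_lift f (Path.refl x) (G := fun _ ↦ (f x : ℂ).arg) continuous_const
    (fun t ↦ by simp [Circle.exp_arg])]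
  ring

/-- **Additivity of the increment under concatenation of paths.** [folklore] -/
theorem incr_trans (f : C(X, Circle)) {x y z : X} (γ : Path x y) (γ' : Path y z) :
    incr f (γ.trans γ') = incr f γ + incr f γ' := by
  set Γ₁ := liftOf f γ with hΓ₁
  set Γ₂ := liftOf f γ' with hΓ₂
  set c : ℝ := Γ₁ 1 - Γ₂ 0 with hc
  have hexpc : Circle.exp c = 1 := by
    rw [hc, Circle.exp_sub, hΓ₁, hΓ₂, exp_liftOf, exp_liftOf, γ.target, γ'.source, div_self']
  -- the concatenated lift, as a real path
  let P₁ : Path (Γ₁ 0) (Γ₁ 1) := ⟨Γ₁, rfl, rfl⟩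
  let P₂ : Path (Γ₁ 1) (Γ₂ 1 + c) := ⟨⟨fun t ↦ Γ₂ t + c, by fun_prop⟩, by simp [hc], rfl⟩
  have hlift : ∀ t, Circle.exp ((P₁.trans P₂) t) = f ((γ.trans γ') t) := by
    intro t
    rw [Path.trans_apply, Path.trans_apply]
    split_ifs with h
    · exact exp_liftOf f γ _
    · show Circle.exp (Γ₂ _ + c) = _
      rw [Circle.exp_add, hexpc, mul_one]
      exact exp_liftOf f γ' _
  rw [incr_eq_of_lift f (γ.trans γ') (P₁.trans P₂).continuous hlift, Path.target, Path.source]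
  simp only [incr, hc]
  ring

/-- **The increment is odd under reversal of the path.** [folklore] -/
theorem incr_symm (f : C(X, Circle)) {x y : X} (γ : Path x y) : incr f γ.symm = -incr f γ := by
  rw [incr_eq_of_lift f γ.symm (G := fun t ↦ liftOf f γ (σ t)) (by fun_prop)
    (fun t ↦ by rw [exp_liftOf]; rfl)]
  simp [incr]

/-- **Conjugation invariance**: the increment of `f` along `δ · γ · δ⁻¹` is that along `γ`.
[folklore] -/
theorem incr_conj (f : C(X, Circle)) {x y : X} (δ : Path y x) (γ : Path x x) :
    incr f (δ.trans (γ.trans δ.symm)) = incr f γ := by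
  rw [incr_trans, incr_trans, incr_symm]
  ring

/-- **Additivity in the map**: the increment of a pointwise product is the sum of the increments.
[folklore] -/
theorem incr_mul (f g : C(X, Circle)) {x y : X} (γ : Path x y) :
    incr (f * g) γ = incr f γ + incr g γ := by
  rw [incr_eq_of_lift (f * g) γ (G := fun t ↦ liftOf f γ t + liftOf g γ t) (by fun_prop)
    (fun t ↦ by rw [Circle.exp_add, exp_liftOf, exp_liftOf]; rfl)]
  simp only [incr]
  ring

/-- The increment of a pointwise inverse is the negative. [folklore] -/
theorem incr_inv (f : C(X, Circle)) {x y : X} (γ : Path x y) : incr f⁻¹ γ = -incr f γ := by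
  rw [incr_eq_of_lift f⁻¹ γ (G := fun t ↦ -liftOf f γ t) (by fun_prop)
    (fun t ↦ by rw [Circle.exp_neg, exp_liftOf]; rfl)]
  simp only [incr]
  ring

/-- The increment of the constant map `1` vanishes. [folklore] -/
theorem incr_one {x y : X} (γ : Path x y) : incr (1 : C(X, Circle)) γ = 0 := by
  rw [incr_eq_of_lift (1 : C(X, Circle)) γ (G := fun _ ↦ 0) continuous_const
    (fun t ↦ by rw [Circle.exp_zero]; rfl)]
  simp

/-- The increment of an integer power is the multiple. [folklore] -/
theorem incr_zpow (f : C(X, Circle)) {x y : X} (γ : Path x y) (n : ℤ) :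
    incr (f ^ n) γ = n * incr f γ := by
  induction n using Int.induction_on with
  | zero => simp [incr_one]
  | succ n ih => rw [zpow_add_one, incr_mul, ih]; push_cast; ring
  | pred n ih => rw [zpow_sub_one, incr_mul, incr_inv, ih]; push_cast; ring

/-- A constant map has vanishing increments. [folklore] -/
theorem incr_const (u₀ : Circle) {x y : X} (γ : Path x y) : incr (ContinuousMap.const X u₀) γ = 0 := by
  rw [incr_eq_of_lift (ContinuousMap.const X u₀) γ (G := fun _ ↦ (u₀ : ℂ).arg) continuous_const
    (fun t ↦ by simp [Circle.exp_arg])]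
  simp

/-! ### Winding numbers of loops -/

/-- For a loop the increment is an integer multiple of `2π`. [folklore] -/
theorem exists_int_incr_eq (f : C(X, Circle)) {x : X} (γ : Path x x) :
    ∃ m : ℤ, incr f γ = m * (2 * π) := by
  have h : Circle.exp (liftOf f γ 1) = Circle.exp (liftOf f γ 0) := by
    rw [exp_liftOf, exp_liftOf, γ.source, γ.target]
  obtain ⟨m, hm⟩ := Circle.exp_eq_exp.1 h
  exact ⟨m, by rw [incr, hm]; ring⟩

/-- **The winding number** of the circle-valued map `f` along the loop `γ`: the integer `m` with
`incr f γ = 2π m` (Hatcher 2002, §1.1, proof of Thm. 1.7). [cite: HatcherAT2002, §1.1 Thm. 1.7] -/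
def winding (f : C(X, Circle)) {x : X} (γ : Path x x) : ℤ := (exists_int_incr_eq f γ).choose

/-- The defining property of the winding number. [folklore] -/
theorem incr_eq_winding (f : C(X, Circle)) {x : X} (γ : Path x x) :
    incr f γ = winding f γ * (2 * π) :=
  (exists_int_incr_eq f γ).choose_spec

/-- Characterisation of the winding number by the increment. [folklore] -/
theorem winding_eq_iff (f : C(X, Circle)) {x : X} (γ : Path x x) (m : ℤ) :
    winding f γ = m ↔ incr f γ = m * (2 * π) := by
  rw [incr_eq_winding]
  constructor
  · rintro rfl; rfl
  · intro h
    have := mul_right_cancel₀ (by positivity : (2 * π : ℝ) ≠ 0) h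
    exact_mod_cast this

/-- **A continuous real lift computes the winding number**: if `exp (G t) = f (γ t)` then
`G 1 - G 0 = 2π · winding f γ`. [cite: HatcherAT2002, Prop. 1.30] -/
theorem winding_eq_of_lift (f : C(X, Circle)) {x : X} (γ : Path x x) {G : I → ℝ}
    (hG : Continuous G) (hlift : ∀ t, Circle.exp (G t) = f (γ t)) (m : ℤ)
    (hm : G 1 - G 0 = m * (2 * π)) : winding f γ = m := by
  rw [winding_eq_iff, incr_eq_of_lift f γ hG hlift, hm]

/-- Winding numbers only depend on the circle-valued loop. [folklore] -/
theorem winding_congr {Y : Type*} [TopologicalSpace Y] (f : C(X, Circle)) (g : C(Y, Circle))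
    {x : X} {x' : Y} (γ : Path x x) (γ' : Path x' x') (h : ∀ t, f (γ t) = g (γ' t)) :
    winding f γ = winding g γ' := by
  rw [winding_eq_iff, incr_congr f g γ γ' h, incr_eq_winding]

/-- **Conjugation invariance of winding numbers.** [folklore] -/
theorem winding_conj (f : C(X, Circle)) {x y : X} (δ : Path y x) (γ : Path x x) :
    winding f (δ.trans (γ.trans δ.symm)) = winding f γ := by
  rw [winding_eq_iff, incr_conj, incr_eq_winding]

/-- Winding numbers add under pointwise products. [folklore] -/
theorem winding_mul (f g : C(X, Circle)) {x : X} (γ : Path x x) :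
    winding (f * g) γ = winding f γ + winding g γ := by
  rw [winding_eq_iff, incr_mul, incr_eq_winding, incr_eq_winding]
  push_cast
  ring

/-- Winding numbers of pointwise inverses. [folklore] -/
theorem winding_inv (f : C(X, Circle)) {x : X} (γ : Path x x) : winding f⁻¹ γ = -winding f γ := by
  rw [winding_eq_iff, incr_inv, incr_eq_winding]
  push_cast
  ring

/-- Winding numbers of pointwise integer powers. [folklore] -/
theorem winding_zpow (f : C(X, Circle)) {x : X} (γ : Path x x) (n : ℤ) :
    winding (f ^ n) γ = n * winding f γ := by
  rw [winding_eq_iff, incr_zpow, incr_eq_winding]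
  push_cast
  ring

/-- Constant maps have winding number zero. [folklore] -/
theorem winding_const (u₀ : Circle) {x : X} (γ : Path x x) :
    winding (ContinuousMap.const X u₀) γ = 0 := by
  rw [winding_eq_iff, incr_const]
  simp

/-! ### Degrees of circle maps -/

/-- **The standard loop** `t ↦ e^{2πit}` of the circle, based at `1`. [folklore] -/
def stdLoop : Path (1 : Circle) 1 where
  toFun t := Circle.exp (2 * π * t)
  continuous_toFun := by fun_prop
  source' := by simp
  target' := by simp

/-- The standard loop as a function. [folklore] -/
@[simp] theorem stdLoop_apply (t : I) : stdLoop t = Circle.exp (2 * π * t) := rfl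

/-- **The degree** of a circle map `g : S¹ → S¹`: its winding number along the standard loop
(Hatcher 2002, §1.1 Thm. 1.7: the isomorphism `π₁(S¹) ≅ ℤ`). [cite: HatcherAT2002, §1.1 Thm. 1.7] -/
def degree (g : C(Circle, Circle)) : ℤ := winding g stdLoop

/-- The identity has degree `1` (the standard loop lifts to `t ↦ 2πt`). [folklore] -/
theorem degree_id : degree (ContinuousMap.id Circle) = 1 :=
  winding_eq_of_lift _ _ (G := fun t : I ↦ 2 * π * t) (by fun_prop) (fun t ↦ rfl) 1 (by simp)

/-- Degrees add under pointwise products. [folklore] -/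
theorem degree_mul (g h : C(Circle, Circle)) : degree (g * h) = degree g + degree h :=
  winding_mul g h stdLoop

/-- Degrees of pointwise inverses. [folklore] -/
theorem degree_inv (g : C(Circle, Circle)) : degree g⁻¹ = -degree g := winding_inv g stdLoop

/-- Degrees of pointwise integer powers. [folklore] -/
theorem degree_zpow (g : C(Circle, Circle)) (n : ℤ) : degree (g ^ n) = n * degree g :=
  winding_zpow g stdLoop n

/-- Constant maps have degree `0`. [folklore] -/
theorem degree_const (u₀ : Circle) : degree (ContinuousMap.const Circle u₀) = 0 :=
  winding_const u₀ stdLoop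

/-- `degree (z ↦ zⁿ) = n`. [folklore] -/
theorem degree_zpow_id (n : ℤ) : degree (ContinuousMap.id Circle ^ n) = n := by
  rw [degree_zpow, degree_id, mul_one]

/-! ### Torus maps up to homotopy -/

/-- The first coordinate circle `x ↦ (x, 1)` of the torus. [folklore] -/
def inclFst : C(Circle, (Circle × Circle)) := ⟨fun x ↦ (x, 1), by fun_prop⟩

/-- The second coordinate circle `u ↦ (1, u)` of the torus. [folklore] -/
def inclSnd : C(Circle, (Circle × Circle)) := ⟨fun u ↦ (1, u), by fun_prop⟩

/-- The first coordinate circle as a function. [folklore] -/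
@[simp] theorem inclFst_apply (x : Circle) : inclFst x = (x, 1) := rfl

/-- The second coordinate circle as a function. [folklore] -/
@[simp] theorem inclSnd_apply (u : Circle) : inclSnd u = (1, u) := rfl

/-- The coordinate projections of the torus as circle-valued maps. [folklore] -/
def fstC : C((Circle × Circle), Circle) := ⟨Prod.fst, continuous_fst⟩

/-- The second coordinate projection. [folklore] -/
def sndC : C((Circle × Circle), Circle) := ⟨Prod.snd, continuous_snd⟩

/-- The first projection as a function. [folklore] -/
@[simp] theorem fstC_apply (z : (Circle × Circle)) : fstC z = z.1 := rfl

/-- The second projection as a function. [folklore] -/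
@[simp] theorem sndC_apply (z : (Circle × Circle)) : sndC z = z.2 := rfl

/-- **The monomial** `(x, u) ↦ x^p u^q` on the torus. [folklore] -/
def monomial (p q : ℤ) : C((Circle × Circle), Circle) := fstC ^ p * sndC ^ q

/-- The monomial as a function. [folklore] -/
@[simp] theorem monomial_apply (p q : ℤ) (z : (Circle × Circle)) : monomial p q z = z.1 ^ p * z.2 ^ q := by
  simp [monomial]

/-- The first degree of the monomial `x^p u^q` is `p`. [folklore] -/
theorem degree_monomial_comp_inclFst (p q : ℤ) : degree ((monomial p q).comp inclFst) = p := by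
  have : (monomial p q).comp inclFst = ContinuousMap.id Circle ^ p := by
    ext1 x; simp
  rw [this, degree_zpow_id]

/-- The second degree of the monomial `x^p u^q` is `q`. [folklore] -/
theorem degree_monomial_comp_inclSnd (p q : ℤ) : degree ((monomial p q).comp inclSnd) = q := by
  have : (monomial p q).comp inclSnd = ContinuousMap.id Circle ^ q := by
    ext1 x; simp
  rw [this, degree_zpow_id]

/-- First degrees add under pointwise products. [folklore] -/
theorem degree_comp_inclFst_mul (F G : C((Circle × Circle), Circle)) :
    degree ((F * G).comp inclFst) = degree (F.comp inclFst) + degree (G.comp inclFst) := by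
  rw [← degree_mul]; rfl

/-- Second degrees add under pointwise products. [folklore] -/
theorem degree_comp_inclSnd_mul (F G : C((Circle × Circle), Circle)) :
    degree ((F * G).comp inclSnd) = degree (F.comp inclSnd) + degree (G.comp inclSnd) := by
  rw [← degree_mul]; rfl

/-- First degrees of pointwise inverses. [folklore] -/
theorem degree_comp_inclFst_inv (F : C((Circle × Circle), Circle)) :
    degree (F⁻¹.comp inclFst) = -degree (F.comp inclFst) := by
  rw [← degree_inv]; rfl

/-- Second degrees of pointwise inverses. [folklore] -/
theorem degree_comp_inclSnd_inv (F : C((Circle × Circle), Circle)) :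
    degree (F⁻¹.comp inclSnd) = -degree (F.comp inclSnd) := by
  rw [← degree_inv]; rfl

/-- The universal cover `ℝ² → T²`, `(s, t) ↦ (e^{is}, e^{it})`. [folklore] -/
def cover2 : C(ℝ × ℝ, (Circle × Circle)) := ⟨fun st ↦ (Circle.exp st.1, Circle.exp st.2), by fun_prop⟩

/-- The universal cover as a function. [folklore] -/
@[simp] theorem cover2_apply (st : ℝ × ℝ) : cover2 st = (Circle.exp st.1, Circle.exp st.2) := rfl

/-- The universal cover is onto. [folklore] -/
theorem cover2_surjective : Function.Surjective cover2 := by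
  rintro ⟨x, u⟩
  exact ⟨((x : ℂ).arg, (u : ℂ).arg), by simp [Circle.exp_arg]⟩

/-- The universal cover is an open map. [folklore] -/
theorem isOpenMap_cover2 : IsOpenMap cover2 :=
  (isLocalHomeomorph_circleExp.isOpenMap.prodMap isLocalHomeomorph_circleExp.isOpenMap)

/-- The universal cover is a quotient map. [folklore] -/
theorem isQuotientMap_cover2 : Topology.IsQuotientMap cover2 :=
  isOpenMap_cover2.isQuotientMap cover2.continuous cover2_surjective

/-- A function invariant under a translation is invariant under its integer multiples. [folklore] -/
theorem apply_add_zsmul_of_apply_add {f : ℝ × ℝ → ℝ} {v : ℝ × ℝ} (h : ∀ st, f (st + v) = f st)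
    (m : ℤ) (st : ℝ × ℝ) : f (st + m • v) = f st := by
  induction m using Int.induction_on generalizing st with
  | zero => rw [zero_smul, add_zero]
  | succ k ih => rw [add_smul, one_smul, ← add_assoc, h, ih]
  | pred k ih =>
    have e : st + (-(k : ℤ) - 1) • v + v = st + (-(k : ℤ)) • v := by
      rw [sub_smul, one_smul]; abel
    rw [← h, e, ih]

/-- A function on `ℝ²` invariant under a vector with `cover2 (st + v) = cover2 st` whose
difference quotient along `v` is integer valued and vanishes once vanishes identically: used for the
two periods of a lift. [folklore] -/
theorem period_eq_zero_of_lift (L : C(ℝ × ℝ, ℝ)) (v : ℝ × ℝ)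
    (hint : ∀ st : ℝ × ℝ, ∃ k : ℤ, (L (st + v) - L st) / (2 * π) = k)
    (h0 : L (0 + v) - L 0 = 0) (st : ℝ × ℝ) : L (st + v) = L st := by
  have hc : Continuous fun st : ℝ × ℝ ↦ (L (st + v) - L st) / (2 * π) := by fun_prop
  have h := apply_eq_of_isPreconnected_of_forall_int isPreconnected_univ hc.continuousOn
    (fun st _ ↦ hint st) (mem_univ st) (mem_univ 0)
  rw [h0, zero_div, div_eq_zero_iff] at h
  rcases h with h | h
  · linarith
  · exfalso; linarith [Real.pi_pos]

/-- **A torus map to the circle with both degrees zero lifts to a continuous real function**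
(lifting criterion, Hatcher 2002, Prop. 1.33, through the universal cover `ℝ² → T²`: the lift to
`ℝ²` has both periods equal to `2π ·` the degrees). [cite: HatcherAT2002, Prop. 1.33] -/
theorem exists_lift_of_degree_eq_zero (G : C((Circle × Circle), Circle))
    (h₁ : degree (G.comp inclFst) = 0) (h₂ : degree (G.comp inclSnd) = 0) :
    ∃ Λ : C((Circle × Circle), ℝ), ∀ z, Circle.exp (Λ z) = G z := by
  -- lift `G ∘ cover2` to `ℝ`
  haveI : SimplyConnectedSpace (ℝ × ℝ) := by
    haveI : ContractibleSpace (ℝ × ℝ) :=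
      (Homeomorph.Set.univ (ℝ × ℝ)).contractibleSpace_iff.1
        ((convex_univ : Convex ℝ (univ : Set (ℝ × ℝ))).contractibleSpace univ_nonempty)
    infer_instance
  obtain ⟨L, ⟨-, hL⟩, -⟩ := Circle.isCoveringMap_exp.existsUnique_continuousMap_lifts
    (G.comp cover2) (0, 0) ((G (1, 1) : ℂ).arg) (by simp [Circle.exp_arg])
  have hLst : ∀ st : ℝ × ℝ, Circle.exp (L st) = G (cover2 st) := fun st ↦ congr_fun hL st
  -- integrality of the difference quotients along the two basic periods
  have hint : ∀ (v : ℝ × ℝ) (hv : ∀ st, cover2 (st + v) = cover2 st) (st : ℝ × ℝ),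
      ∃ k : ℤ, (L (st + v) - L st) / (2 * π) = k := by
    intro v hv st
    obtain ⟨m, hm⟩ := Circle.exp_eq_exp.1 (show Circle.exp (L (st + v)) = Circle.exp (L st) by
      rw [hLst, hLst, hv])
    exact ⟨m, by rw [hm]; field_simp; ring⟩
  have hv₁ : ∀ st : ℝ × ℝ, cover2 (st + (2 * π, 0)) = cover2 st := fun st ↦ by simp
  have hv₂ : ∀ st : ℝ × ℝ, cover2 (st + (0, 2 * π)) = cover2 st := fun st ↦ by simp
  -- the two periods vanish: they are `2π ·` the degrees
  have hp₁ : L (0 + (2 * π, 0)) - L 0 = 0 := by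
    have e := incr_eq_of_lift (G.comp inclFst) stdLoop (G := fun t : I ↦ L (2 * π * t, 0))
      (by fun_prop) (fun t ↦ by rw [hLst]; simp)
    rw [incr_eq_winding] at e
    have hw : winding (G.comp inclFst) stdLoop = 0 := h₁
    rw [hw] at e
    simp only [Int.cast_zero, zero_mul, Set.Icc.coe_one, mul_one, Set.Icc.coe_zero, mul_zero] at e
    rw [zero_add, Prod.mk_zero_zero.symm] at *
    linarith
  have hp₂ : L (0 + (0, 2 * π)) - L 0 = 0 := by
    have e := incr_eq_of_lift (G.comp inclSnd) stdLoop (G := fun t : I ↦ L (0, 2 * π * t))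
      (by fun_prop) (fun t ↦ by rw [hLst]; simp)
    rw [incr_eq_winding] at e
    have hw : winding (G.comp inclSnd) stdLoop = 0 := h₂
    rw [hw] at e
    simp only [Int.cast_zero, zero_mul, Set.Icc.coe_one, mul_one, Set.Icc.coe_zero, mul_zero] at e
    rw [zero_add, Prod.mk_zero_zero.symm] at *
    linarith
  have hper₁ : ∀ st, L (st + (2 * π, 0)) = L st := period_eq_zero_of_lift L _ (hint _ hv₁) hp₁
  have hper₂ : ∀ st, L (st + (0, 2 * π)) = L st := period_eq_zero_of_lift L _ (hint _ hv₂) hp₂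
  -- integer multiples of the periods
  have hperZ₁ : ∀ (m : ℤ) (st : ℝ × ℝ), L (st + ((m : ℝ) * (2 * π), 0)) = L st := fun m st ↦ by
    have := apply_add_zsmul_of_apply_add (f := L) hper₁ m st
    simpa [zsmul_eq_mul] using this
  have hperZ₂ : ∀ (m : ℤ) (st : ℝ × ℝ), L (st + (0, (m : ℝ) * (2 * π))) = L st := fun m st ↦ by
    have := apply_add_zsmul_of_apply_add (f := L) hper₂ m st
    simpa [zsmul_eq_mul] using this
  -- descend to the torus
  set Λ : (Circle × Circle) → ℝ := fun z ↦ L ((z.1 : ℂ).arg, (z.2 : ℂ).arg) with hΛ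
  have hΛc : ∀ st : ℝ × ℝ, Λ (cover2 st) = L st := by
    rintro ⟨s, t⟩
    obtain ⟨m, hm⟩ := Circle.exp_eq_exp.1 (Circle.exp_arg (Circle.exp s))
    obtain ⟨n, hn⟩ := Circle.exp_eq_exp.1 (Circle.exp_arg (Circle.exp t))
    simp only [hΛ, cover2_apply, hm, hn]
    have e : ((s + m * (2 * π), t + n * (2 * π)) : ℝ × ℝ) =
        (s, t) + ((m : ℝ) * (2 * π), 0) + (0, (n : ℝ) * (2 * π)) := by
      ext <;> simp
    rw [e, hperZ₂, hperZ₁]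
  have hcont : Continuous Λ := by
    rw [isQuotientMap_cover2.continuous_iff]
    have e : Λ ∘ cover2 = L := funext hΛc
    rw [e]
    exact L.continuous
  refine ⟨⟨Λ, hcont⟩, fun z ↦ ?_⟩
  obtain ⟨st, rfl⟩ := cover2_surjective z
  show Circle.exp (Λ (cover2 st)) = G (cover2 st)
  rw [hΛc, hLst]

/-- **A torus map to the circle is homotopic to the monomial with its two degrees**
(Hatcher 2002, §1.1 Thm. 1.7 and Example 1.13: `[T², S¹] = Hom(ℤ², ℤ) = ℤ²`). Proof:
`F / (x^p u^q)` has both degrees zero, hence is `exp` of a continuous real function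
(`exists_lift_of_degree_eq_zero`), which is scaled to `0`. [cite: HatcherAT2002, §1.1 Thm. 1.7] -/
theorem homotopic_monomial_of_degree (F : C((Circle × Circle), Circle)) {p q : ℤ}
    (h₁ : degree (F.comp inclFst) = p) (h₂ : degree (F.comp inclSnd) = q) :
    F.Homotopic (monomial p q) := by
  set G := F * (monomial p q)⁻¹ with hG
  have hG₁ : degree (G.comp inclFst) = 0 := by
    rw [hG, degree_comp_inclFst_mul, degree_comp_inclFst_inv, degree_monomial_comp_inclFst, h₁]
    ring
  have hG₂ : degree (G.comp inclSnd) = 0 := by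
    rw [hG, degree_comp_inclSnd_mul, degree_comp_inclSnd_inv, degree_monomial_comp_inclSnd, h₂]
    ring
  obtain ⟨Λ, hΛ⟩ := exists_lift_of_degree_eq_zero G hG₁ hG₂
  refine ⟨{ toFun := fun lz ↦ Circle.exp ((1 - (lz.1 : ℝ)) * Λ lz.2) * monomial p q lz.2
            continuous_toFun := by fun_prop
            map_zero_left := fun z ↦ ?_
            map_one_left := fun z ↦ ?_ }⟩
  · show Circle.exp ((1 - 0) * Λ z) * monomial p q z = F z
    rw [sub_zero, one_mul, hΛ, hG, ContinuousMap.mul_apply, ContinuousMap.inv_apply,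
      mul_assoc, inv_mul_cancel, mul_one]
  · show Circle.exp ((1 - 1) * Λ z) * monomial p q z = monomial p q z
    simp

/-- **A torus self-map is homotopic to the standard map with its four degrees.** [folklore] -/
theorem homotopic_prodMk_of_degree (F₁ F₂ : C((Circle × Circle), Circle)) {p₁ q₁ p₂ q₂ : ℤ}
    (h₁₁ : degree (F₁.comp inclFst) = p₁) (h₁₂ : degree (F₁.comp inclSnd) = q₁)
    (h₂₁ : degree (F₂.comp inclFst) = p₂) (h₂₂ : degree (F₂.comp inclSnd) = q₂) :
    (F₁.prodMk F₂).Homotopic ((monomial p₁ q₁).prodMk (monomial p₂ q₂)) :=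
  ⟨(homotopic_monomial_of_degree F₁ h₁₁ h₁₂).some.prod (homotopic_monomial_of_degree F₂ h₂₁ h₂₂).some⟩

end CircleMaps

end Literature.Topology.FourManifolds
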